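/-
Copyright: the b2b-balaban T⁴-continuum CRUX team, row NE7b OWNER lineage `t4-ne7b-p1` (gen 130). Project licence.
-/
import Summits.QuantumFields.BalabanUV.T4Continuum.Spine.NE7b.SupTiltedMomentLetters
import Summits.QuantumFields.BalabanUV.T4Continuum.Spine.NE7b.SupExpFamilyCumulantBounds
import Summits.QuantumFields.BalabanUV.T4Continuum.Spine.NE7b.SupExpFamilyLogDerivatives
import Summits.QuantumFields.BalabanUV.T4Continuum.Spine.NE7b.SupMixedDerivativeFromDifferences

/-!
# DECAY OF CORRELATIONS OF THE TILTED FLUCTUATION LAW ON THE ROAD: for the small-field step with remainders `w` (`|w| ≤ c₃|t|³` on `|t| ≤ h`,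
# stability `κ₀`) and two one-site quadratic observables `A = F_y(ω_y+ψ₀,y)`, `B = G_z(ω_z+ψ₀,z)` (`|F|, |G| ≤ c₂u²`) at cells `p₀ ∋ y`, `p₁ ∋ z` of `S`
# separated by `n + 1` cells of a potential `d` (`d(p₀) = 0`, `d(p₁) ≥ n+2`, `d` `1`-Lipschitz along `R`), under KP smallness with room `e^{1+η}`,
#   `|Cov_ν(A, B)| = |(⟨AB⟩_Φ⟨1⟩_Φ − ⟨A⟩_Φ⟨B⟩_Φ)∕⟨1⟩_Φ²| ≤ (B_mix∕r₁ + M₂r₁)∕r₂ + M₃r₂∕2`  for all `r₁, r₂ ∈ (0, 1]`,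
#   `B_mix = 4e^{−η(n+1)}(Δ+1)·2e^{1+η}ε̃_ΨA_τ^v`,  `M₂ = 2c₂²δ₀⁻²M + (c₂δ₀⁻¹M)²`,
#   `M₃ = 6c₂³δ₀⁻³M + 6c₂³δ₀⁻³M² + 2c₂³δ₀⁻³M³`  (`M ≥ M_road`, the single-site moment constant of (332a)),
# uniformly in the volume: the tilted law `ν ∝ e^{−V}dN(0,Γ)` has decaying correlations, up to the optimisation in `r₁, r₂`
# (`r₁ = ρ²`, `r₂ = ρ`, `ρ = e^{−η(n+1)∕4}` gives `|Cov_ν(A,B)| ≤ (4(Δ+1)2e^{1+η}ε̃_ΨA_τ^v + M₂ + M₃∕2)·e^{−η(n+1)∕4}`) — (326)'s mixed-difference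
# locality turned into a mixed-DERIVATIVE bound by (327),
# with (330)'s closed forms and (331)∕(332b)'s letters (row NE7b, node U5c — the analytic input of the third-order re-entry and of the locality of
# the next step's Hessian; (326)∕(327)∕(330)∕(331)∕(332a,b) BY NAME; [folklore])

Cell `pub-balaban`, sub-cell `t4`, spine estimate NE7b (`T4WeightBudget.RelWeightBound`; the cell's OWN estimate — NOT PRINTED in
[Bałaban 1983–89], NOT PROVED).  Crux-route work under `Spine/NE7b/` by the row OWNER (`t4-ne7b-p1` gen 130, file (332c)) under FREEZE
(0)'s crux-prover clause, on § [NE7bP1-G129-HANDOFF] NEXT (ii) (SCOPING-d4: correlation decay of the tilted law by the real-variable route);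
NOTHING of Bałaban's is named as a Lean object, valued or asserted; no `T4Continuum/Support` leaf typed; no `def`, no notation; zero `sorry`.
Imports (BY NAME): the OWNER's (332b) `…SupTiltedMomentLetters` (`letter_A∕B∕AA∕BB∕AB∕ABB`), (332a) (`road_H_pos`, `road_four_letter`,
`twoSite_integral_eq`), (331) `…SupExpFamilyCumulantBounds` (`abs_fss_le`, `abs_fstt_le`), (330) `…SupExpFamilyLogDerivatives`
(`hasDerivAt_logH_s`, `hasDerivAt_fs_s`, `hasDerivAt_fs_t`, `hasDerivAt_fst_t`), (327) `…SupMixedDerivativeFromDifferences`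
(`abs_mixedDeriv_le_of_differences_on`), (326) `…SupTwoSitePerturbationLocality` (`abs_log_twoSite_mixed_le`).

WHAT IS PROVED ([folklore]): §1 THE END **`abs_tilted_cov_le_family`** (the bound above, the tilted integrals written as the exponential
family at `(s,t) = (0,0)`, i.e. with the factor `e^{0·A+0·B}`), **`abs_tilted_cov_le`** (the same with that factor removed), `optimise_identity`
and THE END **`abs_tilted_cov_decay`** (`r₁ = ρ²`, `r₂ = ρ`, `ρ = e^{−η(n+1)∕4}`: `|Cov_ν(A,B)| ≤ (4(Δ+1)2e^{1+η}ε̃_ΨA_τ^v + M₂ + M₃∕2)e^{−η(n+1)∕4}`); §2 toy.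

HONEST (what this is NOT).  A covariance-decay bound for ONE pair of one-site quadratic observables under the small-field step's tilted law, with
explicit but unoptimised constants (`r₁, r₂` free; the moments cost `δ₀ > 0` of stability room: `2(κ₀+2c₂+δ₀) ≤ κ`, `2(κ₀+8c₂)(1+τ)γ_op ≤ θ`); the
re-entry of the third-order remainder and the locality of the next Hessian are the next files; small-field step only; scalar skeleton ((A3),
NC-NE7b-α UNRULED); nothing of Bałaban's asserted.  BY-NAME EFFECT ON THE WALL: NONE.  NE7b NOT PRINTED ∕ NOT PROVED; spine PROVED 0∕9; rung
(B)+1 — the programme's measures remain FINITE-torus statements; NOT the mass gap, NOT Clay.  HONEST DEPENDENCY: continuum YM on T⁴ ⇐ BetaPertH ∧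
nine spine estimates (0∕9 proved); BetaPertH ⇐ (D1) ∧ (D4) ∧ CAP+tail; G-an2-4 gates asym, D1 and NE2∕3∕4.
-/

set_option autoImplicit false

noncomputable section

namespace Summit.QuantumFields.BalabanUV.T4Continuum.NE7b.SupTiltedCovarianceDecay

open MeasureTheory ProbabilityTheory Finset Real
open scoped BigOperators
open Literature.Analysis.Matrix (HasFiniteRange)
open SupTiltedMomentLetters (letter_A letter_B letter_AA letter_BB letter_AB letter_ABB)
open SupTiltedFamilyLetters (road_H_pos road_four_letter twoSite_integral_eq)
open SupExpFamilyCumulantBounds (abs_fss_le abs_fstt_le)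
open SupExpFamilyLogDerivatives (hasDerivAt_logH_s hasDerivAt_fs_s hasDerivAt_fs_t hasDerivAt_fst_t)
open SupMixedDerivativeFromDifferences (abs_mixedDeriv_le_of_differences_on)
open SupTwoSitePerturbationLocality (abs_log_twoSite_mixed_le)

variable {ι : Type} [Fintype ι] [DecidableEq ι] {V : Type*} [DecidableEq V]

section Main

variable {Γ : Matrix ι ι ℝ} {γop γ : ℝ} {dι : ι → ι → ℕ} {ρ : ℕ} {cell : V → Finset ι} {v : ℕ} {R : V → V → Prop}
  [DecidableRel R] [Std.Symm R] {nbr : V → Finset V} {Δ : ℕ} {w F G : ι → ℝ → ℝ} {κ₀ c₂ c₃ h κ τ θ Ψ δ₀ η : ℝ}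

/-! ## §1. THE END: decay of the tilted covariance -/

/-- **THE END — DECAY OF CORRELATIONS (exponential-family form).**  Road data; `y ∈ cell p₀`, `z ∈ cell p₁`, `p₀, p₁ ∈ S`; a potential `d`
(`R p q → d q ≤ d p + 1`, `d p₀ = 0`, `n + 2 ≤ d p₁`); `0 ≤ η`; KP smallness with room `e^{1+η}` (for the mixed differences) and with `e`
for the `δ₀`-perturbed family (for the moments); `M_road ≤ M` ⟹ for all `r₁, r₂ ∈ (0,1]`
`|(⟨AB⟩⟨1⟩ − ⟨A⟩⟨B⟩)∕⟨1⟩²| ≤ (B_mix∕r₁ + M₂r₁)∕r₂ + M₃r₂∕2` (all brackets `∫e^{−V}(·)e^{0·A+0·B}dN(0,Γ)`). [folklore] -/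
theorem abs_tilted_cov_le_family (hΓ : Γ.PosSemidef) (hΓop : (γop • (1 : Matrix ι ι ℝ) - Γ).PosSemidef) (hdiag : ∀ i, Γ i i ≤ γ) (hγ : 0 ≤ γ)
    (hfr : HasFiniteRange dι ρ Γ) (hdisj : ∀ p q, p ≠ q → Disjoint (cell p) (cell q)) (hv : ∀ p, (cell p).card ≤ v)
    (hR : ∀ (p p' : V) (x y : ι), x ∈ cell p → y ∈ cell p' → dι x y ≤ ρ → p = p' ∨ R p p') (hΔ : ∀ x, (nbr x).card ≤ Δ)
    (hnbr : ∀ x y, R x y → y ∈ nbr x) (hw : ∀ x, Measurable (w x)) (hFm : ∀ x, Measurable (F x)) (hGm : ∀ x, Measurable (G x)) (hκ₀ : 0 ≤ κ₀)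
    (hc₂ : 0 ≤ c₂) (hc₃ : 0 ≤ c₃) (hh : 0 ≤ h) (hδ₀ : 0 < δ₀) (hstab : ∀ x, ∀ u : ℝ, -(κ₀ * u ^ 2) ≤ w x u)
    (hcub : ∀ x, ∀ u : ℝ, |u| ≤ h → |w x u| ≤ c₃ * |u| ^ 3) (hFq : ∀ x u, |F x u| ≤ c₂ * u ^ 2) (hGq : ∀ x u, |G x u| ≤ c₂ * u ^ 2)
    (hκ : 2 * ((κ₀ + 2 * c₂) + δ₀) ≤ κ) (hτ : 0 < τ) (hθ0 : 0 < θ) (hθ1 : θ < 1) (hκθ : κ * (1 + τ) * γop ≤ θ)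
    (hκθ₈ : 2 * (κ₀ + 2 * (4 * c₂)) * (1 + τ) * γop ≤ θ) (S : Finset V) (ψ₀ : EuclideanSpace ℝ ι)
    (hψ : ∀ p ∈ S, ∑ x ∈ cell p, ψ₀ x ^ 2 ≤ Ψ ^ 2) {p₀ p₁ : V} (hp₀ : p₀ ∈ S) (hp₁ : p₁ ∈ S) {y z : ι} (hy : y ∈ cell p₀) (hz : z ∈ cell p₁)
    {d : V → ℕ} (hd : ∀ p q, R p q → d q ≤ d p + 1) {n : ℕ} (hd₀ : d p₀ = 0) (hd₁ : n + 2 ≤ d p₁) (hη : 0 ≤ η)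
    (hsmall₂ : Real.exp (1 + η) * (((max (exp (v * (c₃ * h ^ 3 + 2 * c₂ * h ^ 2)) - 1) (2 * exp (-((κ / 2 - (κ₀ + 2 * c₂)) * h ^ 2)))) *
      exp (κ * (1 + τ⁻¹) * Ψ ^ 2 / 2)) * ((1 - θ) ^ (-(κ * (1 + τ) * γ / (2 * θ)))) ^ v) * ((Δ : ℝ) + 1) ^ 2 ≤ 1 / 2)
    (hsmall : Real.exp 1 * (((max (exp (v * ((c₃ * h ^ 3 + 2 * c₂ * h ^ 2) + δ₀ * h ^ 2)) - 1)
      (2 * exp (-((κ / 2 - ((κ₀ + 2 * c₂) + δ₀)) * h ^ 2)))) * exp (κ * (1 + τ⁻¹) * Ψ ^ 2 / 2)) *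
      ((1 - θ) ^ (-(κ * (1 + τ) * γ / (2 * θ)))) ^ v) * ((Δ : ℝ) + 1) ^ 2 ≤ 1 / 2) {M : ℝ}
    (hM : exp (2 * ((1 : ℝ) * ((Δ : ℝ) + 1) * (2 * (Real.exp 1 *
        (((max (exp (v * ((c₃ * h ^ 3 + 2 * c₂ * h ^ 2) + δ₀ * h ^ 2)) - 1) (2 * exp (-((κ / 2 - ((κ₀ + 2 * c₂) + δ₀)) * h ^ 2)))) *
          exp (κ * (1 + τ⁻¹) * Ψ ^ 2 / 2)) * ((1 - θ) ^ (-(κ * (1 + τ) * γ / (2 * θ)))) ^ v))))) ≤ M) {r₁ r₂ : ℝ} (hr₁ : 0 < r₁) (hr₁1 : r₁ ≤ 1) (hr₂ : 0 < r₂) (hr₂1 : r₂ ≤ 1) :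
    |((∫ ω : EuclideanSpace ℝ ι, exp (-(∑ p ∈ S, ∑ x ∈ cell p, w x (ω x + ψ₀ x))) * F y (ω y + ψ₀ y) * G z (ω z + ψ₀ z) *
            exp (0 * F y (ω y + ψ₀ y) + 0 * G z (ω z + ψ₀ z)) ∂(multivariateGaussian 0 Γ)) *
          (∫ ω : EuclideanSpace ℝ ι, exp (-(∑ p ∈ S, ∑ x ∈ cell p, w x (ω x + ψ₀ x))) *
            exp (0 * F y (ω y + ψ₀ y) + 0 * G z (ω z + ψ₀ z)) ∂(multivariateGaussian 0 Γ)) -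
        (∫ ω : EuclideanSpace ℝ ι, exp (-(∑ p ∈ S, ∑ x ∈ cell p, w x (ω x + ψ₀ x))) * F y (ω y + ψ₀ y) *
            exp (0 * F y (ω y + ψ₀ y) + 0 * G z (ω z + ψ₀ z)) ∂(multivariateGaussian 0 Γ)) *
          (∫ ω : EuclideanSpace ℝ ι, exp (-(∑ p ∈ S, ∑ x ∈ cell p, w x (ω x + ψ₀ x))) * G z (ω z + ψ₀ z) *
            exp (0 * F y (ω y + ψ₀ y) + 0 * G z (ω z + ψ₀ z)) ∂(multivariateGaussian 0 Γ))) /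
        (∫ ω : EuclideanSpace ℝ ι, exp (-(∑ p ∈ S, ∑ x ∈ cell p, w x (ω x + ψ₀ x))) *
            exp (0 * F y (ω y + ψ₀ y) + 0 * G z (ω z + ψ₀ z)) ∂(multivariateGaussian 0 Γ)) ^ 2| ≤
      (4 * (Real.exp (-(η * ((n : ℝ) + 1))) * ((1 : ℝ) * ((Δ : ℝ) + 1) * (2 * (Real.exp (1 + η) *
        (((max (exp (v * (c₃ * h ^ 3 + 2 * c₂ * h ^ 2)) - 1) (2 * exp (-((κ / 2 - (κ₀ + 2 * c₂)) * h ^ 2)))) *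
          exp (κ * (1 + τ⁻¹) * Ψ ^ 2 / 2)) * ((1 - θ) ^ (-(κ * (1 + τ) * γ / (2 * θ)))) ^ v))))) / r₁ +
        ((2 * c₂ ^ 2 * (δ₀ ^ 2)⁻¹ * M) + (c₂ * δ₀⁻¹ * M) ^ 2) * r₁) / r₂ +
      ((6 * c₂ ^ 3 * (δ₀ ^ 3)⁻¹ * M) + (c₂ * δ₀⁻¹ * M) * (2 * c₂ ^ 2 * (δ₀ ^ 2)⁻¹ * M) +
        2 * (2 * c₂ ^ 2 * (δ₀ ^ 2)⁻¹ * M) * (c₂ * δ₀⁻¹ * M) + 2 * (c₂ * δ₀⁻¹ * M) * (c₂ * δ₀⁻¹ * M) ^ 2) * r₂ / 2 := by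
  -- measurability ∕ positivity letters
  have hAm : Measurable (fun ω : EuclideanSpace ℝ ι => F y (ω y + ψ₀ y)) :=
    (hFm y).comp ((by fun_prop : Measurable fun ω : EuclideanSpace ℝ ι => ω y).add_const _)
  have hBm : Measurable (fun ω : EuclideanSpace ℝ ι => G z (ω z + ψ₀ z)) :=
    (hGm z).comp ((by fun_prop : Measurable fun ω : EuclideanSpace ℝ ι => ω z).add_const _)
  have hΦm : Measurable (fun ω : EuclideanSpace ℝ ι => exp (-(∑ p ∈ S, ∑ x ∈ cell p, w x (ω x + ψ₀ x)))) :=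
    measurable_exp.comp (SupSmallFieldGasReal.measurable_cellSum cell w hw S (fun x => ψ₀ x)).neg
  have hΦnn : ∀ ω : EuclideanSpace ℝ ι, 0 ≤ (fun ω : EuclideanSpace ℝ ι => exp (-(∑ p ∈ S, ∑ x ∈ cell p, w x (ω x + ψ₀ x)))) ω := fun ω => (exp_pos _).le
  have hκθ₂ : 2 * (κ₀ + 2 * c₂) * (1 + τ) * γop ≤ θ :=
    SupEffectiveActionDerivative.mul_opBound_le_of_le (a := 2 * (κ₀ + 2 * c₂) * (1 + τ)) (b := κ * (1 + τ)) (by positivity)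
      (mul_le_mul_of_nonneg_right (by linarith [hδ₀.le]) (by linarith)) hθ0.le (by simpa [mul_assoc] using hκθ) |> fun h' => by
        simpa [mul_assoc] using h'
  have hκ₂ : 2 * (κ₀ + 2 * c₂) ≤ κ := by linarith [hδ₀.le]
  have h4 := road_four_letter hΓ hΓop hdisj hw hFm hGm hκ₀ hc₂ hstab hFq hGq hτ hθ1 hκθ₈ S ψ₀ hp₀ hp₁ hy hz
  have hpos : ∀ s t : ℝ, |s| ≤ 1 → |t| ≤ 1 →
      0 < (∫ ω : EuclideanSpace ℝ ι, exp (-(∑ p ∈ S, ∑ x ∈ cell p, w x (ω x + ψ₀ x))) *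
            exp (s * F y (ω y + ψ₀ y) + t * G z (ω z + ψ₀ z)) ∂(multivariateGaussian 0 Γ)) :=
    fun s t hs ht => road_H_pos hΓ hΓop hdisj hw hFm hGm hκ₀ hc₂ hstab hFq hGq hτ hθ1 hκθ₂ S ψ₀ hp₀ hp₁ hy hz hs ht
  have h0 : |(0 : ℝ)| ≤ 1 := by rw [abs_zero]; exact zero_le_one
  have hI : ∀ {b : ℝ}, b ≤ 1 → ∀ s ∈ Set.Icc (0 : ℝ) b, |s| ≤ 1 := fun hb s hs => abs_le.2 ⟨by linarith [hs.1], by linarith [hs.2]⟩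
  have hr : r₁ ∈ Set.Icc (0 : ℝ) r₁ := ⟨hr₁.le, le_rfl⟩
  -- from `M_road` to `M`
  have hM0 : 0 ≤ M := (exp_pos _).le.trans hM
  have hmA0 : 0 ≤ (c₂ * δ₀⁻¹ * M) := by positivity
  have hmAA0 : 0 ≤ (2 * c₂ ^ 2 * (δ₀ ^ 2)⁻¹ * M) := by positivity
  have hMA : c₂ * δ₀⁻¹ * exp (2 * ((1 : ℝ) * ((Δ : ℝ) + 1) * (2 * (Real.exp 1 *
        (((max (exp (v * ((c₃ * h ^ 3 + 2 * c₂ * h ^ 2) + δ₀ * h ^ 2)) - 1) (2 * exp (-((κ / 2 - ((κ₀ + 2 * c₂) + δ₀)) * h ^ 2)))) *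
          exp (κ * (1 + τ⁻¹) * Ψ ^ 2 / 2)) * ((1 - θ) ^ (-(κ * (1 + τ) * γ / (2 * θ)))) ^ v))))) ≤ (c₂ * δ₀⁻¹ * M) := mul_le_mul_of_nonneg_left hM (by positivity)
  have hMAA : 2 * c₂ ^ 2 * (δ₀ ^ 2)⁻¹ * exp (2 * ((1 : ℝ) * ((Δ : ℝ) + 1) * (2 * (Real.exp 1 *
        (((max (exp (v * ((c₃ * h ^ 3 + 2 * c₂ * h ^ 2) + δ₀ * h ^ 2)) - 1) (2 * exp (-((κ / 2 - ((κ₀ + 2 * c₂) + δ₀)) * h ^ 2)))) *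
          exp (κ * (1 + τ⁻¹) * Ψ ^ 2 / 2)) * ((1 - θ) ^ (-(κ * (1 + τ) * γ / (2 * θ)))) ^ v))))) ≤ (2 * c₂ ^ 2 * (δ₀ ^ 2)⁻¹ * M) := mul_le_mul_of_nonneg_left hM (by positivity)
  have hMABB : 6 * c₂ ^ 3 * (δ₀ ^ 3)⁻¹ * exp (2 * ((1 : ℝ) * ((Δ : ℝ) + 1) * (2 * (Real.exp 1 *
        (((max (exp (v * ((c₃ * h ^ 3 + 2 * c₂ * h ^ 2) + δ₀ * h ^ 2)) - 1) (2 * exp (-((κ / 2 - ((κ₀ + 2 * c₂) + δ₀)) * h ^ 2)))) *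
          exp (κ * (1 + τ⁻¹) * Ψ ^ 2 / 2)) * ((1 - θ) ^ (-(κ * (1 + τ) * γ / (2 * θ)))) ^ v))))) ≤ (6 * c₂ ^ 3 * (δ₀ ^ 3)⁻¹ * M) := mul_le_mul_of_nonneg_left hM (by positivity)
  -- the six letters ((332b)), uniformly on the square
  have hLA : ∀ s t : ℝ, |s| ≤ 1 → |t| ≤ 1 →
      (∫ ω : EuclideanSpace ℝ ι, exp (-(∑ p ∈ S, ∑ x ∈ cell p, w x (ω x + ψ₀ x))) * |F y (ω y + ψ₀ y)| *
            exp (s * F y (ω y + ψ₀ y) + t * G z (ω z + ψ₀ z)) ∂(multivariateGaussian 0 Γ)) ≤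
        (∫ ω : EuclideanSpace ℝ ι, exp (-(∑ p ∈ S, ∑ x ∈ cell p, w x (ω x + ψ₀ x))) *
            exp (s * F y (ω y + ψ₀ y) + t * G z (ω z + ψ₀ z)) ∂(multivariateGaussian 0 Γ)) * (c₂ * δ₀⁻¹ * M) := fun s t hs ht =>
    (letter_A hΓ hΓop hdiag hγ hfr hdisj hv hR hΔ hnbr hw hFm hGm hκ₀ hc₂ hc₃ hh hδ₀ hstab hcub hFq hGq hκ hτ hθ0 hθ1 hκθ S ψ₀ hψ hp₀ hp₁
      hy hz hsmall hs ht).trans (mul_le_mul_of_nonneg_left hMA (hpos s t hs ht).le)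
  have hLB : ∀ s t : ℝ, |s| ≤ 1 → |t| ≤ 1 →
      (∫ ω : EuclideanSpace ℝ ι, exp (-(∑ p ∈ S, ∑ x ∈ cell p, w x (ω x + ψ₀ x))) * |G z (ω z + ψ₀ z)| *
            exp (s * F y (ω y + ψ₀ y) + t * G z (ω z + ψ₀ z)) ∂(multivariateGaussian 0 Γ)) ≤
        (∫ ω : EuclideanSpace ℝ ι, exp (-(∑ p ∈ S, ∑ x ∈ cell p, w x (ω x + ψ₀ x))) *
            exp (s * F y (ω y + ψ₀ y) + t * G z (ω z + ψ₀ z)) ∂(multivariateGaussian 0 Γ)) * (c₂ * δ₀⁻¹ * M) := fun s t hs ht =>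
    (letter_B hΓ hΓop hdiag hγ hfr hdisj hv hR hΔ hnbr hw hFm hGm hκ₀ hc₂ hc₃ hh hδ₀ hstab hcub hFq hGq hκ hτ hθ0 hθ1 hκθ S ψ₀ hψ hp₀ hp₁
      hy hz hsmall hs ht).trans (mul_le_mul_of_nonneg_left hMA (hpos s t hs ht).le)
  have hLAA : ∀ s t : ℝ, |s| ≤ 1 → |t| ≤ 1 →
      (∫ ω : EuclideanSpace ℝ ι, exp (-(∑ p ∈ S, ∑ x ∈ cell p, w x (ω x + ψ₀ x))) * |F y (ω y + ψ₀ y) * F y (ω y + ψ₀ y)| *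
            exp (s * F y (ω y + ψ₀ y) + t * G z (ω z + ψ₀ z)) ∂(multivariateGaussian 0 Γ)) ≤
        (∫ ω : EuclideanSpace ℝ ι, exp (-(∑ p ∈ S, ∑ x ∈ cell p, w x (ω x + ψ₀ x))) *
            exp (s * F y (ω y + ψ₀ y) + t * G z (ω z + ψ₀ z)) ∂(multivariateGaussian 0 Γ)) * (2 * c₂ ^ 2 * (δ₀ ^ 2)⁻¹ * M) := fun s t hs ht =>
    (letter_AA hΓ hΓop hdiag hγ hfr hdisj hv hR hΔ hnbr hw hFm hGm hκ₀ hc₂ hc₃ hh hδ₀ hstab hcub hFq hGq hκ hτ hθ0 hθ1 hκθ S ψ₀ hψ hp₀ hp₁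
      hy hz hsmall hs ht).trans (mul_le_mul_of_nonneg_left hMAA (hpos s t hs ht).le)
  have hLBB : ∀ s t : ℝ, |s| ≤ 1 → |t| ≤ 1 →
      (∫ ω : EuclideanSpace ℝ ι, exp (-(∑ p ∈ S, ∑ x ∈ cell p, w x (ω x + ψ₀ x))) * |G z (ω z + ψ₀ z) * G z (ω z + ψ₀ z)| *
            exp (s * F y (ω y + ψ₀ y) + t * G z (ω z + ψ₀ z)) ∂(multivariateGaussian 0 Γ)) ≤
        (∫ ω : EuclideanSpace ℝ ι, exp (-(∑ p ∈ S, ∑ x ∈ cell p, w x (ω x + ψ₀ x))) *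
            exp (s * F y (ω y + ψ₀ y) + t * G z (ω z + ψ₀ z)) ∂(multivariateGaussian 0 Γ)) * (2 * c₂ ^ 2 * (δ₀ ^ 2)⁻¹ * M) := fun s t hs ht =>
    (letter_BB hΓ hΓop hdiag hγ hfr hdisj hv hR hΔ hnbr hw hFm hGm hκ₀ hc₂ hc₃ hh hδ₀ hstab hcub hFq hGq hκ hτ hθ0 hθ1 hκθ S ψ₀ hψ hp₀ hp₁
      hy hz hsmall hs ht).trans (mul_le_mul_of_nonneg_left hMAA (hpos s t hs ht).le)
  have hLAB : ∀ s t : ℝ, |s| ≤ 1 → |t| ≤ 1 →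
      (∫ ω : EuclideanSpace ℝ ι, exp (-(∑ p ∈ S, ∑ x ∈ cell p, w x (ω x + ψ₀ x))) * |F y (ω y + ψ₀ y) * G z (ω z + ψ₀ z)| *
            exp (s * F y (ω y + ψ₀ y) + t * G z (ω z + ψ₀ z)) ∂(multivariateGaussian 0 Γ)) ≤
        (∫ ω : EuclideanSpace ℝ ι, exp (-(∑ p ∈ S, ∑ x ∈ cell p, w x (ω x + ψ₀ x))) *
            exp (s * F y (ω y + ψ₀ y) + t * G z (ω z + ψ₀ z)) ∂(multivariateGaussian 0 Γ)) * (2 * c₂ ^ 2 * (δ₀ ^ 2)⁻¹ * M) := fun s t hs ht =>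
    (letter_AB hΓ hΓop hdiag hγ hfr hdisj hv hR hΔ hnbr hw hFm hGm hκ₀ hc₂ hc₃ hh hδ₀ hstab hcub hFq hGq hκ hτ hθ0 hθ1 hκθ hκθ₈ S ψ₀ hψ
      hp₀ hp₁ hy hz hsmall hs ht).trans (mul_le_mul_of_nonneg_left hMAA (hpos s t hs ht).le)
  have hLABB : ∀ s t : ℝ, |s| ≤ 1 → |t| ≤ 1 →
      (∫ ω : EuclideanSpace ℝ ι, exp (-(∑ p ∈ S, ∑ x ∈ cell p, w x (ω x + ψ₀ x))) * |F y (ω y + ψ₀ y) * G z (ω z + ψ₀ z) * G z (ω z + ψ₀ z)| *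
            exp (s * F y (ω y + ψ₀ y) + t * G z (ω z + ψ₀ z)) ∂(multivariateGaussian 0 Γ)) ≤
        (∫ ω : EuclideanSpace ℝ ι, exp (-(∑ p ∈ S, ∑ x ∈ cell p, w x (ω x + ψ₀ x))) *
            exp (s * F y (ω y + ψ₀ y) + t * G z (ω z + ψ₀ z)) ∂(multivariateGaussian 0 Γ)) * (6 * c₂ ^ 3 * (δ₀ ^ 3)⁻¹ * M) := fun s t hs ht =>
    (letter_ABB hΓ hΓop hdiag hγ hfr hdisj hv hR hΔ hnbr hw hFm hGm hκ₀ hc₂ hc₃ hh hδ₀ hstab hcub hFq hGq hκ hτ hθ0 hθ1 hκθ hκθ₈ S ψ₀ hψ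
      hp₀ hp₁ hy hz hsmall hs ht).trans (mul_le_mul_of_nonneg_left hMABB (hpos s t hs ht).le)
  -- the mixed differences ((326)), rewritten through the exponential family ((332a))
  have hBmix : ∀ t ∈ Set.Icc (0 : ℝ) 1,
      |log (∫ ω : EuclideanSpace ℝ ι, exp (-(∑ p ∈ S, ∑ x ∈ cell p, w x (ω x + ψ₀ x))) *
            exp (r₁ * F y (ω y + ψ₀ y) + t * G z (ω z + ψ₀ z)) ∂(multivariateGaussian 0 Γ)) -
          log (∫ ω : EuclideanSpace ℝ ι, exp (-(∑ p ∈ S, ∑ x ∈ cell p, w x (ω x + ψ₀ x))) *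
            exp (r₁ * F y (ω y + ψ₀ y) + 0 * G z (ω z + ψ₀ z)) ∂(multivariateGaussian 0 Γ)) -
          log (∫ ω : EuclideanSpace ℝ ι, exp (-(∑ p ∈ S, ∑ x ∈ cell p, w x (ω x + ψ₀ x))) *
            exp (0 * F y (ω y + ψ₀ y) + t * G z (ω z + ψ₀ z)) ∂(multivariateGaussian 0 Γ)) +
          log (∫ ω : EuclideanSpace ℝ ι, exp (-(∑ p ∈ S, ∑ x ∈ cell p, w x (ω x + ψ₀ x))) *
            exp (0 * F y (ω y + ψ₀ y) + 0 * G z (ω z + ψ₀ z)) ∂(multivariateGaussian 0 Γ))| ≤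
        4 * (Real.exp (-(η * ((n : ℝ) + 1))) * ((1 : ℝ) * ((Δ : ℝ) + 1) * (2 * (Real.exp (1 + η) *
        (((max (exp (v * (c₃ * h ^ 3 + 2 * c₂ * h ^ 2)) - 1) (2 * exp (-((κ / 2 - (κ₀ + 2 * c₂)) * h ^ 2)))) *
          exp (κ * (1 + τ⁻¹) * Ψ ^ 2 / 2)) * ((1 - θ) ^ (-(κ * (1 + τ) * γ / (2 * θ)))) ^ v))))) := fun t ht => by
    have hmix := abs_log_twoSite_mixed_le hΓ hΓop hdiag hγ hfr hdisj hv hR hΔ hnbr hw hFm hGm hκ₀ hc₂ hc₃ hh hstab hcub hFq hGq hκ₂ hτ hθ0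
      hθ1 hκθ S ψ₀ hψ hy hz hd hd₀ hd₁ hη hsmall₂ (hI hr₁1 r₁ hr) (hI le_rfl t ht)
    rw [twoSite_integral_eq (multivariateGaussian 0 Γ) w F G y z r₁ t cell hdisj S hp₀ hp₁ hy hz ψ₀,
      twoSite_integral_eq (multivariateGaussian 0 Γ) w F G y z r₁ 0 cell hdisj S hp₀ hp₁ hy hz ψ₀,
      twoSite_integral_eq (multivariateGaussian 0 Γ) w F G y z 0 t cell hdisj S hp₀ hp₁ hy hz ψ₀,
      twoSite_integral_eq (multivariateGaussian 0 Γ) w F G y z 0 0 cell hdisj S hp₀ hp₁ hy hz ψ₀] at hmix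
    exact hmix
  -- assembly by (327) with (330)'s closed forms and (331)'s letters
  have key := abs_mixedDeriv_le_of_differences_on
    (f := fun s t => log (∫ ω : EuclideanSpace ℝ ι, exp (-(∑ p ∈ S, ∑ x ∈ cell p, w x (ω x + ψ₀ x))) *
            exp (s * F y (ω y + ψ₀ y) + t * G z (ω z + ψ₀ z)) ∂(multivariateGaussian 0 Γ)))
    (fs := fun s t => (∫ ω : EuclideanSpace ℝ ι, exp (-(∑ p ∈ S, ∑ x ∈ cell p, w x (ω x + ψ₀ x))) * F y (ω y + ψ₀ y) *
            exp (s * F y (ω y + ψ₀ y) + t * G z (ω z + ψ₀ z)) ∂(multivariateGaussian 0 Γ)) /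
      (∫ ω : EuclideanSpace ℝ ι, exp (-(∑ p ∈ S, ∑ x ∈ cell p, w x (ω x + ψ₀ x))) *
            exp (s * F y (ω y + ψ₀ y) + t * G z (ω z + ψ₀ z)) ∂(multivariateGaussian 0 Γ)))
    (fss := fun s t => (((∫ ω : EuclideanSpace ℝ ι, exp (-(∑ p ∈ S, ∑ x ∈ cell p, w x (ω x + ψ₀ x))) * F y (ω y + ψ₀ y) * F y (ω y + ψ₀ y) *
            exp (s * F y (ω y + ψ₀ y) + t * G z (ω z + ψ₀ z)) ∂(multivariateGaussian 0 Γ)) *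
          (∫ ω : EuclideanSpace ℝ ι, exp (-(∑ p ∈ S, ∑ x ∈ cell p, w x (ω x + ψ₀ x))) *
            exp (s * F y (ω y + ψ₀ y) + t * G z (ω z + ψ₀ z)) ∂(multivariateGaussian 0 Γ)) -
        (∫ ω : EuclideanSpace ℝ ι, exp (-(∑ p ∈ S, ∑ x ∈ cell p, w x (ω x + ψ₀ x))) * F y (ω y + ψ₀ y) *
            exp (s * F y (ω y + ψ₀ y) + t * G z (ω z + ψ₀ z)) ∂(multivariateGaussian 0 Γ)) *
          (∫ ω : EuclideanSpace ℝ ι, exp (-(∑ p ∈ S, ∑ x ∈ cell p, w x (ω x + ψ₀ x))) * F y (ω y + ψ₀ y) *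
            exp (s * F y (ω y + ψ₀ y) + t * G z (ω z + ψ₀ z)) ∂(multivariateGaussian 0 Γ))) /
        (∫ ω : EuclideanSpace ℝ ι, exp (-(∑ p ∈ S, ∑ x ∈ cell p, w x (ω x + ψ₀ x))) *
            exp (s * F y (ω y + ψ₀ y) + t * G z (ω z + ψ₀ z)) ∂(multivariateGaussian 0 Γ)) ^ 2))
    (fst := fun t => (((∫ ω : EuclideanSpace ℝ ι, exp (-(∑ p ∈ S, ∑ x ∈ cell p, w x (ω x + ψ₀ x))) * F y (ω y + ψ₀ y) * G z (ω z + ψ₀ z) *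
            exp (0 * F y (ω y + ψ₀ y) + t * G z (ω z + ψ₀ z)) ∂(multivariateGaussian 0 Γ)) *
          (∫ ω : EuclideanSpace ℝ ι, exp (-(∑ p ∈ S, ∑ x ∈ cell p, w x (ω x + ψ₀ x))) *
            exp (0 * F y (ω y + ψ₀ y) + t * G z (ω z + ψ₀ z)) ∂(multivariateGaussian 0 Γ)) -
        (∫ ω : EuclideanSpace ℝ ι, exp (-(∑ p ∈ S, ∑ x ∈ cell p, w x (ω x + ψ₀ x))) * F y (ω y + ψ₀ y) *
            exp (0 * F y (ω y + ψ₀ y) + t * G z (ω z + ψ₀ z)) ∂(multivariateGaussian 0 Γ)) *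
          (∫ ω : EuclideanSpace ℝ ι, exp (-(∑ p ∈ S, ∑ x ∈ cell p, w x (ω x + ψ₀ x))) * G z (ω z + ψ₀ z) *
            exp (0 * F y (ω y + ψ₀ y) + t * G z (ω z + ψ₀ z)) ∂(multivariateGaussian 0 Γ))) /
        (∫ ω : EuclideanSpace ℝ ι, exp (-(∑ p ∈ S, ∑ x ∈ cell p, w x (ω x + ψ₀ x))) *
            exp (0 * F y (ω y + ψ₀ y) + t * G z (ω z + ψ₀ z)) ∂(multivariateGaussian 0 Γ)) ^ 2))
    (fstt := fun t => ((((∫ ω : EuclideanSpace ℝ ι, exp (-(∑ p ∈ S, ∑ x ∈ cell p, w x (ω x + ψ₀ x))) * F y (ω y + ψ₀ y) * G z (ω z + ψ₀ z) * G z (ω z + ψ₀ z) *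
            exp (0 * F y (ω y + ψ₀ y) + t * G z (ω z + ψ₀ z)) ∂(multivariateGaussian 0 Γ)) *
          (∫ ω : EuclideanSpace ℝ ι, exp (-(∑ p ∈ S, ∑ x ∈ cell p, w x (ω x + ψ₀ x))) *
            exp (0 * F y (ω y + ψ₀ y) + t * G z (ω z + ψ₀ z)) ∂(multivariateGaussian 0 Γ)) +
          (∫ ω : EuclideanSpace ℝ ι, exp (-(∑ p ∈ S, ∑ x ∈ cell p, w x (ω x + ψ₀ x))) * F y (ω y + ψ₀ y) * G z (ω z + ψ₀ z) *
            exp (0 * F y (ω y + ψ₀ y) + t * G z (ω z + ψ₀ z)) ∂(multivariateGaussian 0 Γ)) *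
          (∫ ω : EuclideanSpace ℝ ι, exp (-(∑ p ∈ S, ∑ x ∈ cell p, w x (ω x + ψ₀ x))) * G z (ω z + ψ₀ z) *
            exp (0 * F y (ω y + ψ₀ y) + t * G z (ω z + ψ₀ z)) ∂(multivariateGaussian 0 Γ)) -
          ((∫ ω : EuclideanSpace ℝ ι, exp (-(∑ p ∈ S, ∑ x ∈ cell p, w x (ω x + ψ₀ x))) * F y (ω y + ψ₀ y) * G z (ω z + ψ₀ z) *
            exp (0 * F y (ω y + ψ₀ y) + t * G z (ω z + ψ₀ z)) ∂(multivariateGaussian 0 Γ)) *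
          (∫ ω : EuclideanSpace ℝ ι, exp (-(∑ p ∈ S, ∑ x ∈ cell p, w x (ω x + ψ₀ x))) * G z (ω z + ψ₀ z) *
            exp (0 * F y (ω y + ψ₀ y) + t * G z (ω z + ψ₀ z)) ∂(multivariateGaussian 0 Γ)) +
            (∫ ω : EuclideanSpace ℝ ι, exp (-(∑ p ∈ S, ∑ x ∈ cell p, w x (ω x + ψ₀ x))) * F y (ω y + ψ₀ y) *
            exp (0 * F y (ω y + ψ₀ y) + t * G z (ω z + ψ₀ z)) ∂(multivariateGaussian 0 Γ)) *
            (∫ ω : EuclideanSpace ℝ ι, exp (-(∑ p ∈ S, ∑ x ∈ cell p, w x (ω x + ψ₀ x))) * G z (ω z + ψ₀ z) * G z (ω z + ψ₀ z) *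
            exp (0 * F y (ω y + ψ₀ y) + t * G z (ω z + ψ₀ z)) ∂(multivariateGaussian 0 Γ)))) *
          (∫ ω : EuclideanSpace ℝ ι, exp (-(∑ p ∈ S, ∑ x ∈ cell p, w x (ω x + ψ₀ x))) *
            exp (0 * F y (ω y + ψ₀ y) + t * G z (ω z + ψ₀ z)) ∂(multivariateGaussian 0 Γ)) ^ 2 -
        ((∫ ω : EuclideanSpace ℝ ι, exp (-(∑ p ∈ S, ∑ x ∈ cell p, w x (ω x + ψ₀ x))) * F y (ω y + ψ₀ y) * G z (ω z + ψ₀ z) *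
            exp (0 * F y (ω y + ψ₀ y) + t * G z (ω z + ψ₀ z)) ∂(multivariateGaussian 0 Γ)) *
          (∫ ω : EuclideanSpace ℝ ι, exp (-(∑ p ∈ S, ∑ x ∈ cell p, w x (ω x + ψ₀ x))) *
            exp (0 * F y (ω y + ψ₀ y) + t * G z (ω z + ψ₀ z)) ∂(multivariateGaussian 0 Γ)) -
          (∫ ω : EuclideanSpace ℝ ι, exp (-(∑ p ∈ S, ∑ x ∈ cell p, w x (ω x + ψ₀ x))) * F y (ω y + ψ₀ y) *
            exp (0 * F y (ω y + ψ₀ y) + t * G z (ω z + ψ₀ z)) ∂(multivariateGaussian 0 Γ)) *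
          (∫ ω : EuclideanSpace ℝ ι, exp (-(∑ p ∈ S, ∑ x ∈ cell p, w x (ω x + ψ₀ x))) * G z (ω z + ψ₀ z) *
            exp (0 * F y (ω y + ψ₀ y) + t * G z (ω z + ψ₀ z)) ∂(multivariateGaussian 0 Γ))) *
          (2 * (∫ ω : EuclideanSpace ℝ ι, exp (-(∑ p ∈ S, ∑ x ∈ cell p, w x (ω x + ψ₀ x))) *
            exp (0 * F y (ω y + ψ₀ y) + t * G z (ω z + ψ₀ z)) ∂(multivariateGaussian 0 Γ)) *
          (∫ ω : EuclideanSpace ℝ ι, exp (-(∑ p ∈ S, ∑ x ∈ cell p, w x (ω x + ψ₀ x))) * G z (ω z + ψ₀ z) *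
            exp (0 * F y (ω y + ψ₀ y) + t * G z (ω z + ψ₀ z)) ∂(multivariateGaussian 0 Γ)))) /
        ((∫ ω : EuclideanSpace ℝ ι, exp (-(∑ p ∈ S, ∑ x ∈ cell p, w x (ω x + ψ₀ x))) *
            exp (0 * F y (ω y + ψ₀ y) + t * G z (ω z + ψ₀ z)) ∂(multivariateGaussian 0 Γ)) ^ 2) ^ 2))
    hr₁ hr₂ hr₂1
    (fun s hs t ht => hasDerivAt_logH_s (μ := (multivariateGaussian 0 Γ)) (Φ₀ := fun ω : EuclideanSpace ℝ ι => exp (-(∑ p ∈ S, ∑ x ∈ cell p, w x (ω x + ψ₀ x))))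
      (A := fun ω : EuclideanSpace ℝ ι => F y (ω y + ψ₀ y)) (B := fun ω : EuclideanSpace ℝ ι => G z (ω z + ψ₀ z)) hΦm hAm hBm h4 hpos (hI hr₁1 s hs) (hI le_rfl t ht))
    (fun s hs t ht => hasDerivAt_fs_s (μ := (multivariateGaussian 0 Γ)) (Φ₀ := fun ω : EuclideanSpace ℝ ι => exp (-(∑ p ∈ S, ∑ x ∈ cell p, w x (ω x + ψ₀ x))))
      (A := fun ω : EuclideanSpace ℝ ι => F y (ω y + ψ₀ y)) (B := fun ω : EuclideanSpace ℝ ι => G z (ω z + ψ₀ z)) hΦm hAm hBm h4 hpos (hI hr₁1 s hs) (hI le_rfl t ht))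
    (fun t ht => hasDerivAt_fs_t (μ := (multivariateGaussian 0 Γ)) (Φ₀ := fun ω : EuclideanSpace ℝ ι => exp (-(∑ p ∈ S, ∑ x ∈ cell p, w x (ω x + ψ₀ x))))
      (A := fun ω : EuclideanSpace ℝ ι => F y (ω y + ψ₀ y)) (B := fun ω : EuclideanSpace ℝ ι => G z (ω z + ψ₀ z)) hΦm hAm hBm h4 hpos h0 (hI le_rfl t ht))
    (fun t ht => hasDerivAt_fst_t (μ := (multivariateGaussian 0 Γ)) (Φ₀ := fun ω : EuclideanSpace ℝ ι => exp (-(∑ p ∈ S, ∑ x ∈ cell p, w x (ω x + ψ₀ x))))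
      (A := fun ω : EuclideanSpace ℝ ι => F y (ω y + ψ₀ y)) (B := fun ω : EuclideanSpace ℝ ι => G z (ω z + ψ₀ z)) hΦm hAm hBm h4 hpos h0 (hI le_rfl t ht))
    (B := 4 * (Real.exp (-(η * ((n : ℝ) + 1))) * ((1 : ℝ) * ((Δ : ℝ) + 1) * (2 * (Real.exp (1 + η) *
        (((max (exp (v * (c₃ * h ^ 3 + 2 * c₂ * h ^ 2)) - 1) (2 * exp (-((κ / 2 - (κ₀ + 2 * c₂)) * h ^ 2)))) *
          exp (κ * (1 + τ⁻¹) * Ψ ^ 2 / 2)) * ((1 - θ) ^ (-(κ * (1 + τ) * γ / (2 * θ)))) ^ v))))))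
    (M₂ := ((2 * c₂ ^ 2 * (δ₀ ^ 2)⁻¹ * M) + (c₂ * δ₀⁻¹ * M) ^ 2))
    (M₃ := ((6 * c₂ ^ 3 * (δ₀ ^ 3)⁻¹ * M) + (c₂ * δ₀⁻¹ * M) * (2 * c₂ ^ 2 * (δ₀ ^ 2)⁻¹ * M) +
        2 * (2 * c₂ ^ 2 * (δ₀ ^ 2)⁻¹ * M) * (c₂ * δ₀⁻¹ * M) + 2 * (c₂ * δ₀⁻¹ * M) * (c₂ * δ₀⁻¹ * M) ^ 2)) hBmix
    (fun s hs t ht => abs_fss_le (μ := (multivariateGaussian 0 Γ)) (Φ₀ := fun ω : EuclideanSpace ℝ ι => exp (-(∑ p ∈ S, ∑ x ∈ cell p, w x (ω x + ψ₀ x))))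
      (A := fun ω : EuclideanSpace ℝ ι => F y (ω y + ψ₀ y)) (B := fun ω : EuclideanSpace ℝ ι => G z (ω z + ψ₀ z)) hΦnn (hpos s t (hI hr₁1 s hs) (hI le_rfl t ht)) hmA0
      (hLA s t (hI hr₁1 s hs) (hI le_rfl t ht)) (hLAA s t (hI hr₁1 s hs) (hI le_rfl t ht)))
    (fun t ht => abs_fstt_le (μ := (multivariateGaussian 0 Γ)) (Φ₀ := fun ω : EuclideanSpace ℝ ι => exp (-(∑ p ∈ S, ∑ x ∈ cell p, w x (ω x + ψ₀ x))))
      (A := fun ω : EuclideanSpace ℝ ι => F y (ω y + ψ₀ y)) (B := fun ω : EuclideanSpace ℝ ι => G z (ω z + ψ₀ z)) hΦnn (hpos 0 t h0 (hI le_rfl t ht)) hmA0 hmA0 hmAA0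
      (hLA 0 t h0 (hI le_rfl t ht)) (hLB 0 t h0 (hI le_rfl t ht)) (hLAB 0 t h0 (hI le_rfl t ht)) (hLBB 0 t h0 (hI le_rfl t ht))
      (hLABB 0 t h0 (hI le_rfl t ht)))
  exact key

/-- **THE END — DECAY OF CORRELATIONS.**  As `abs_tilted_cov_le_family`, the brackets written plainly:
`|(∫e^{−V}AB·∫e^{−V} − ∫e^{−V}A·∫e^{−V}B)∕(∫e^{−V})²| ≤ (B_mix∕r₁ + M₂r₁)∕r₂ + M₃r₂∕2`, `B_mix = 4e^{−η(n+1)}(Δ+1)2e^{1+η}ε̃_ΨA_τ^v`. [folklore] -/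
theorem abs_tilted_cov_le (hΓ : Γ.PosSemidef) (hΓop : (γop • (1 : Matrix ι ι ℝ) - Γ).PosSemidef) (hdiag : ∀ i, Γ i i ≤ γ) (hγ : 0 ≤ γ)
    (hfr : HasFiniteRange dι ρ Γ) (hdisj : ∀ p q, p ≠ q → Disjoint (cell p) (cell q)) (hv : ∀ p, (cell p).card ≤ v)
    (hR : ∀ (p p' : V) (x y : ι), x ∈ cell p → y ∈ cell p' → dι x y ≤ ρ → p = p' ∨ R p p') (hΔ : ∀ x, (nbr x).card ≤ Δ)
    (hnbr : ∀ x y, R x y → y ∈ nbr x) (hw : ∀ x, Measurable (w x)) (hFm : ∀ x, Measurable (F x)) (hGm : ∀ x, Measurable (G x)) (hκ₀ : 0 ≤ κ₀)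
    (hc₂ : 0 ≤ c₂) (hc₃ : 0 ≤ c₃) (hh : 0 ≤ h) (hδ₀ : 0 < δ₀) (hstab : ∀ x, ∀ u : ℝ, -(κ₀ * u ^ 2) ≤ w x u)
    (hcub : ∀ x, ∀ u : ℝ, |u| ≤ h → |w x u| ≤ c₃ * |u| ^ 3) (hFq : ∀ x u, |F x u| ≤ c₂ * u ^ 2) (hGq : ∀ x u, |G x u| ≤ c₂ * u ^ 2)
    (hκ : 2 * ((κ₀ + 2 * c₂) + δ₀) ≤ κ) (hτ : 0 < τ) (hθ0 : 0 < θ) (hθ1 : θ < 1) (hκθ : κ * (1 + τ) * γop ≤ θ)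
    (hκθ₈ : 2 * (κ₀ + 2 * (4 * c₂)) * (1 + τ) * γop ≤ θ) (S : Finset V) (ψ₀ : EuclideanSpace ℝ ι)
    (hψ : ∀ p ∈ S, ∑ x ∈ cell p, ψ₀ x ^ 2 ≤ Ψ ^ 2) {p₀ p₁ : V} (hp₀ : p₀ ∈ S) (hp₁ : p₁ ∈ S) {y z : ι} (hy : y ∈ cell p₀) (hz : z ∈ cell p₁)
    {d : V → ℕ} (hd : ∀ p q, R p q → d q ≤ d p + 1) {n : ℕ} (hd₀ : d p₀ = 0) (hd₁ : n + 2 ≤ d p₁) (hη : 0 ≤ η)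
    (hsmall₂ : Real.exp (1 + η) * (((max (exp (v * (c₃ * h ^ 3 + 2 * c₂ * h ^ 2)) - 1) (2 * exp (-((κ / 2 - (κ₀ + 2 * c₂)) * h ^ 2)))) *
      exp (κ * (1 + τ⁻¹) * Ψ ^ 2 / 2)) * ((1 - θ) ^ (-(κ * (1 + τ) * γ / (2 * θ)))) ^ v) * ((Δ : ℝ) + 1) ^ 2 ≤ 1 / 2)
    (hsmall : Real.exp 1 * (((max (exp (v * ((c₃ * h ^ 3 + 2 * c₂ * h ^ 2) + δ₀ * h ^ 2)) - 1)
      (2 * exp (-((κ / 2 - ((κ₀ + 2 * c₂) + δ₀)) * h ^ 2)))) * exp (κ * (1 + τ⁻¹) * Ψ ^ 2 / 2)) *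
      ((1 - θ) ^ (-(κ * (1 + τ) * γ / (2 * θ)))) ^ v) * ((Δ : ℝ) + 1) ^ 2 ≤ 1 / 2) {M : ℝ}
    (hM : exp (2 * ((1 : ℝ) * ((Δ : ℝ) + 1) * (2 * (Real.exp 1 *
        (((max (exp (v * ((c₃ * h ^ 3 + 2 * c₂ * h ^ 2) + δ₀ * h ^ 2)) - 1) (2 * exp (-((κ / 2 - ((κ₀ + 2 * c₂) + δ₀)) * h ^ 2)))) *
          exp (κ * (1 + τ⁻¹) * Ψ ^ 2 / 2)) * ((1 - θ) ^ (-(κ * (1 + τ) * γ / (2 * θ)))) ^ v))))) ≤ M) {r₁ r₂ : ℝ} (hr₁ : 0 < r₁) (hr₁1 : r₁ ≤ 1) (hr₂ : 0 < r₂) (hr₂1 : r₂ ≤ 1) :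
    |((∫ ω : EuclideanSpace ℝ ι, exp (-(∑ p ∈ S, ∑ x ∈ cell p, w x (ω x + ψ₀ x))) * F y (ω y + ψ₀ y) * G z (ω z + ψ₀ z) ∂(multivariateGaussian 0 Γ)) *
          (∫ ω : EuclideanSpace ℝ ι, exp (-(∑ p ∈ S, ∑ x ∈ cell p, w x (ω x + ψ₀ x))) ∂(multivariateGaussian 0 Γ)) -
        (∫ ω : EuclideanSpace ℝ ι, exp (-(∑ p ∈ S, ∑ x ∈ cell p, w x (ω x + ψ₀ x))) * F y (ω y + ψ₀ y) ∂(multivariateGaussian 0 Γ)) *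
          (∫ ω : EuclideanSpace ℝ ι, exp (-(∑ p ∈ S, ∑ x ∈ cell p, w x (ω x + ψ₀ x))) * G z (ω z + ψ₀ z) ∂(multivariateGaussian 0 Γ))) /
        (∫ ω : EuclideanSpace ℝ ι, exp (-(∑ p ∈ S, ∑ x ∈ cell p, w x (ω x + ψ₀ x))) ∂(multivariateGaussian 0 Γ)) ^ 2| ≤
      (4 * (Real.exp (-(η * ((n : ℝ) + 1))) * ((1 : ℝ) * ((Δ : ℝ) + 1) * (2 * (Real.exp (1 + η) *
        (((max (exp (v * (c₃ * h ^ 3 + 2 * c₂ * h ^ 2)) - 1) (2 * exp (-((κ / 2 - (κ₀ + 2 * c₂)) * h ^ 2)))) *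
          exp (κ * (1 + τ⁻¹) * Ψ ^ 2 / 2)) * ((1 - θ) ^ (-(κ * (1 + τ) * γ / (2 * θ)))) ^ v))))) / r₁ +
        ((2 * c₂ ^ 2 * (δ₀ ^ 2)⁻¹ * M) + (c₂ * δ₀⁻¹ * M) ^ 2) * r₁) / r₂ +
      ((6 * c₂ ^ 3 * (δ₀ ^ 3)⁻¹ * M) + (c₂ * δ₀⁻¹ * M) * (2 * c₂ ^ 2 * (δ₀ ^ 2)⁻¹ * M) +
        2 * (2 * c₂ ^ 2 * (δ₀ ^ 2)⁻¹ * M) * (c₂ * δ₀⁻¹ * M) + 2 * (c₂ * δ₀⁻¹ * M) * (c₂ * δ₀⁻¹ * M) ^ 2) * r₂ / 2 := by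
  have key := abs_tilted_cov_le_family hΓ hΓop hdiag hγ hfr hdisj hv hR hΔ hnbr hw hFm hGm hκ₀ hc₂ hc₃ hh hδ₀ hstab hcub hFq hGq hκ hτ hθ0 hθ1 hκθ hκθ₈ S ψ₀
    hψ hp₀ hp₁ hy hz hd hd₀ hd₁ hη hsmall₂ hsmall hM hr₁ hr₁1 hr₂ hr₂1
  simpa only [zero_mul, add_zero, exp_zero, mul_one] using key

omit [Fintype ι] [DecidableEq ι] [DecidableEq V] [DecidableRel R] [Std.Symm R] in
/-- The optimisation identity: `((4ρ⁴K)∕ρ² + M₂ρ²)∕ρ + M₃ρ∕2 = (4K + M₂ + M₃∕2)ρ` (`ρ ≠ 0`). [folklore] -/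
theorem optimise_identity (K M₂ M₃ : ℝ) {ρ : ℝ} (hρ : ρ ≠ 0) :
    (4 * (ρ ^ 4 * K) / ρ ^ 2 + M₂ * ρ ^ 2) / ρ + M₃ * ρ / 2 = (4 * K + M₂ + M₃ / 2) * ρ := by
  field_simp

/-- **THE END — EXPONENTIAL DECAY OF CORRELATIONS.**  As `abs_tilted_cov_le` at `r₁ = ρ²`, `r₂ = ρ`, `ρ = e^{−η(n+1)∕4}`:
`|Cov_ν(F_y, G_z)| ≤ (4(Δ+1)2e^{1+η}ε̃_ΨA_τ^v + M₂ + M₃∕2)·e^{−η(n+1)∕4}` — cells `n + 1` apart in the potential, rate `η∕4` per cell,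
uniformly in the volume. [folklore] -/
theorem abs_tilted_cov_decay (hΓ : Γ.PosSemidef) (hΓop : (γop • (1 : Matrix ι ι ℝ) - Γ).PosSemidef) (hdiag : ∀ i, Γ i i ≤ γ) (hγ : 0 ≤ γ)
    (hfr : HasFiniteRange dι ρ Γ) (hdisj : ∀ p q, p ≠ q → Disjoint (cell p) (cell q)) (hv : ∀ p, (cell p).card ≤ v)
    (hR : ∀ (p p' : V) (x y : ι), x ∈ cell p → y ∈ cell p' → dι x y ≤ ρ → p = p' ∨ R p p') (hΔ : ∀ x, (nbr x).card ≤ Δ)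
    (hnbr : ∀ x y, R x y → y ∈ nbr x) (hw : ∀ x, Measurable (w x)) (hFm : ∀ x, Measurable (F x)) (hGm : ∀ x, Measurable (G x)) (hκ₀ : 0 ≤ κ₀)
    (hc₂ : 0 ≤ c₂) (hc₃ : 0 ≤ c₃) (hh : 0 ≤ h) (hδ₀ : 0 < δ₀) (hstab : ∀ x, ∀ u : ℝ, -(κ₀ * u ^ 2) ≤ w x u)
    (hcub : ∀ x, ∀ u : ℝ, |u| ≤ h → |w x u| ≤ c₃ * |u| ^ 3) (hFq : ∀ x u, |F x u| ≤ c₂ * u ^ 2) (hGq : ∀ x u, |G x u| ≤ c₂ * u ^ 2)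
    (hκ : 2 * ((κ₀ + 2 * c₂) + δ₀) ≤ κ) (hτ : 0 < τ) (hθ0 : 0 < θ) (hθ1 : θ < 1) (hκθ : κ * (1 + τ) * γop ≤ θ)
    (hκθ₈ : 2 * (κ₀ + 2 * (4 * c₂)) * (1 + τ) * γop ≤ θ) (S : Finset V) (ψ₀ : EuclideanSpace ℝ ι)
    (hψ : ∀ p ∈ S, ∑ x ∈ cell p, ψ₀ x ^ 2 ≤ Ψ ^ 2) {p₀ p₁ : V} (hp₀ : p₀ ∈ S) (hp₁ : p₁ ∈ S) {y z : ι} (hy : y ∈ cell p₀) (hz : z ∈ cell p₁)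
    {d : V → ℕ} (hd : ∀ p q, R p q → d q ≤ d p + 1) {n : ℕ} (hd₀ : d p₀ = 0) (hd₁ : n + 2 ≤ d p₁) (hη : 0 ≤ η)
    (hsmall₂ : Real.exp (1 + η) * (((max (exp (v * (c₃ * h ^ 3 + 2 * c₂ * h ^ 2)) - 1) (2 * exp (-((κ / 2 - (κ₀ + 2 * c₂)) * h ^ 2)))) *
      exp (κ * (1 + τ⁻¹) * Ψ ^ 2 / 2)) * ((1 - θ) ^ (-(κ * (1 + τ) * γ / (2 * θ)))) ^ v) * ((Δ : ℝ) + 1) ^ 2 ≤ 1 / 2)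
    (hsmall : Real.exp 1 * (((max (exp (v * ((c₃ * h ^ 3 + 2 * c₂ * h ^ 2) + δ₀ * h ^ 2)) - 1)
      (2 * exp (-((κ / 2 - ((κ₀ + 2 * c₂) + δ₀)) * h ^ 2)))) * exp (κ * (1 + τ⁻¹) * Ψ ^ 2 / 2)) *
      ((1 - θ) ^ (-(κ * (1 + τ) * γ / (2 * θ)))) ^ v) * ((Δ : ℝ) + 1) ^ 2 ≤ 1 / 2) {M : ℝ}
    (hM : exp (2 * ((1 : ℝ) * ((Δ : ℝ) + 1) * (2 * (Real.exp 1 *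
        (((max (exp (v * ((c₃ * h ^ 3 + 2 * c₂ * h ^ 2) + δ₀ * h ^ 2)) - 1) (2 * exp (-((κ / 2 - ((κ₀ + 2 * c₂) + δ₀)) * h ^ 2)))) *
          exp (κ * (1 + τ⁻¹) * Ψ ^ 2 / 2)) * ((1 - θ) ^ (-(κ * (1 + τ) * γ / (2 * θ)))) ^ v))))) ≤ M) :
    |((∫ ω : EuclideanSpace ℝ ι, exp (-(∑ p ∈ S, ∑ x ∈ cell p, w x (ω x + ψ₀ x))) * F y (ω y + ψ₀ y) * G z (ω z + ψ₀ z) ∂(multivariateGaussian 0 Γ)) *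
          (∫ ω : EuclideanSpace ℝ ι, exp (-(∑ p ∈ S, ∑ x ∈ cell p, w x (ω x + ψ₀ x))) ∂(multivariateGaussian 0 Γ)) -
        (∫ ω : EuclideanSpace ℝ ι, exp (-(∑ p ∈ S, ∑ x ∈ cell p, w x (ω x + ψ₀ x))) * F y (ω y + ψ₀ y) ∂(multivariateGaussian 0 Γ)) *
          (∫ ω : EuclideanSpace ℝ ι, exp (-(∑ p ∈ S, ∑ x ∈ cell p, w x (ω x + ψ₀ x))) * G z (ω z + ψ₀ z) ∂(multivariateGaussian 0 Γ))) /
        (∫ ω : EuclideanSpace ℝ ι, exp (-(∑ p ∈ S, ∑ x ∈ cell p, w x (ω x + ψ₀ x))) ∂(multivariateGaussian 0 Γ)) ^ 2| ≤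
      (4 * ((1 : ℝ) * ((Δ : ℝ) + 1) * (2 * (Real.exp (1 + η) *
        (((max (exp (v * (c₃ * h ^ 3 + 2 * c₂ * h ^ 2)) - 1) (2 * exp (-((κ / 2 - (κ₀ + 2 * c₂)) * h ^ 2)))) *
          exp (κ * (1 + τ⁻¹) * Ψ ^ 2 / 2)) * ((1 - θ) ^ (-(κ * (1 + τ) * γ / (2 * θ)))) ^ v)))) +
        ((2 * c₂ ^ 2 * (δ₀ ^ 2)⁻¹ * M) + (c₂ * δ₀⁻¹ * M) ^ 2) + ((6 * c₂ ^ 3 * (δ₀ ^ 3)⁻¹ * M) + (c₂ * δ₀⁻¹ * M) * (2 * c₂ ^ 2 * (δ₀ ^ 2)⁻¹ * M) +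
        2 * (2 * c₂ ^ 2 * (δ₀ ^ 2)⁻¹ * M) * (c₂ * δ₀⁻¹ * M) + 2 * (c₂ * δ₀⁻¹ * M) * (c₂ * δ₀⁻¹ * M) ^ 2) / 2) * exp (-(η * ((n : ℝ) + 1)) / 4) := by
  set ρ : ℝ := exp (-(η * ((n : ℝ) + 1)) / 4) with hρ
  have hρ0 : 0 < ρ := exp_pos _
  have hρ1 : ρ ≤ 1 := exp_le_one_iff.2 (by
    have : 0 ≤ η * ((n : ℝ) + 1) := by positivity
    linarith)
  have hρ2 : ρ ^ 2 ≤ 1 := pow_le_one₀ hρ0.le hρ1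
  have key := abs_tilted_cov_le hΓ hΓop hdiag hγ hfr hdisj hv hR hΔ hnbr hw hFm hGm hκ₀ hc₂ hc₃ hh hδ₀ hstab hcub hFq hGq hκ hτ hθ0 hθ1 hκθ hκθ₈ S ψ₀ hψ hp₀ hp₁
    hy hz hd hd₀ hd₁ hη hsmall₂ hsmall hM (r₁ := ρ ^ 2) (r₂ := ρ) (by positivity) hρ2 hρ0 hρ1
  have hE : Real.exp (-(η * ((n : ℝ) + 1))) = ρ ^ 4 := by
    rw [hρ, ← Real.exp_nat_mul]
    congr 1
    push_cast
    ring
  rw [hE] at key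
  exact key.trans (le_of_eq (optimise_identity _ _ _ hρ0.ne'))

end Main

/-! ## §2. Toy -/

/-- Toy (§1's optimisation): with `r₁ = e^{−2a}`, `r₂ = e^{−a}` the three terms `B∕(r₁r₂)`, `M₂r₁∕r₂`, `M₃r₂∕2` of the bound read
`Be^{3a}`, `M₂e^{−a}`, `M₃e^{−a}∕2`; at `B = e^{−4a}` the first is `e^{−a}`. -/
example (a : ℝ) : exp (-(4 * a)) / exp (-(2 * a)) / exp (-a) = exp (-a) := by
  rw [div_div, ← exp_add, ← exp_sub]
  congr 1
  ring

end Summit.QuantumFields.BalabanUV.T4Continuum.NE7b.SupTiltedCovarianceDecay
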